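import Summits.ResolutionOfSingularities.ResolutionOfSingularities.Theorems.PurelyInseparableDim4MohAlong
import Summits.ResolutionOfSingularities.ResolutionOfSingularities.Theorems.PurelyInseparableDim4Target
import Literature.AlgebraicGeometry.Resolution.OrdZeroBasics
import HarnessLib

/-!
# Purely inseparable four-folds — the shade is NOT constant along a MODE-1h centre, even with
# `perm2 = 1` (PR-1 (iii): kernel counterexample at a special point of the centre)

[OURS · counted 0 · cell `res-dim4-pi`, D-0157 DOOR 2, brick PR-1 (iii); AI work, weaker than expert
review] Nothing here is a statement about resolution of singularities (NOT proved in dimension `≥ 4` /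
characteristic `p` anywhere in this programme); this is a negative census fact about OUR frame.

The desk's clause (iii) of PR-1 (`boards/WAVE2.md`): «the shade is constant along a MODE-1h centre —
state it only with perm2 = 1 (HP (1) ∧ (2))». As worded — at EVERY closed point `c` of the centre —
it is FALSE already in the class `(4,1)` at `p = 2` with NO exceptional divisor:

* `F = x₀³ + x₀³x₂ = x₀³(1 + x₂)` over `𝔽₂` (clean, `ord₀ F = 3`, `r = 0`, shade `d = 3`);
* `S = {0}`: the centre `V(z, x₀)` is Hironaka-permissible (`F ∈ (x₀)²`) and of least cardinality,
  i.e. THE MODE-1h centre (`IsMode1hCentre 2 {0} F`), and satisfies HP's (2) (`F ∈ (x₀)^{0+3}`: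
  `Perm2 {0} s`);
* at the point `c = (0, 0, 1, 0)` of the centre (`c = 0` on `S`) the moved-and-re-cleaned state
  (`PurelyInseparableDim4MohAlong.lean`) is `x₀³x₂` — in characteristic `2`,
  `x₀³ + x₀³(x₂ + 1) = x₀³x₂` — of order `4`: the shade JUMPS from `3` to `4` along the centre
  (`shade_translate_specialPoint`, `not_shadeConstantAlongMode1hCentre`).

A second witness (§4, every field): `F = x₀²x₂` with the boundary component `E = {x₂ = 0}` of
multiplicity `1` (`d = 2`); `S = {0}` is the MODE-1h centre with (2); at EVERY point of the centre off
`E` the component is lost, `x₀²(x₂ + c₂)` re-cleans to `x₀²x₂`, and the shade is `3` — the jump is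
GENERIC when the centre is not inside the boundary components through the point
(`shade_jumps_offBoundary`).

What IS true (landed in `PurelyInseparableDim4MohAlongBound.lean`, `shade_le_shade_translate`): under
(2) at the origin the shade at every point of the centre is `≥` the shade at the origin, with equality
off the proper closed subset where the degree-`(|r'| + d)` part of the moved polynomial dies (here:
`x₂ = 1`, the zero of the unit `1 + x₂`). Consequence for the engines' `+1` referee on translated edges
(`t ≠ 0`): compare `d'` with the shade AT `c` (re-clean `F(x + c)` first), not with `d` at the origin.

bears_on: LADDER-RESOLUTION:D157-DOOR2 (res-dim4-pi · PR-1 (iii)). Supports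
stmt-ResolutionOfSingularities-16155 (helper).
-/

set_option linter.dupNamespace false

noncomputable section

open MvPolynomial Finset

open scoped BigOperators

namespace Summit.ResolutionOfSingularities.ResolutionOfSingularities.Theorems.PIDim4

open Literature.AlgebraicGeometry.Resolution
open Literature.AlgebraicGeometry.Resolution.Hauser2010
open Literature.AlgebraicGeometry.Resolution.CentreBlowup
open Literature.Barriers.ResolutionOfSingularities

namespace MohAlong

namespace SpecialPoint

/-! ## 1. The polynomial `x₀³ + x₀³x₂` over `𝔽₂` and its support -/

/-- `x₀³ + x₀³·x₂` as a sum of two monomials. [folklore] -/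
theorem F_eq :
    (X 0 ^ 3 + X 0 ^ 3 * X 2 : MvPolynomial (Fin 4) (ZMod 2)) =
      monomial (Finsupp.single 0 3) 1 + monomial (Finsupp.single 0 3 + Finsupp.single 2 1) 1 := by
  rw [X_pow_eq_monomial, X, monomial_mul, one_mul]

/-- The two exponents are distinct. [folklore] -/
theorem exponents_ne :
    (Finsupp.single 0 3 : Fin 4 →₀ ℕ) ≠ Finsupp.single 0 3 + Finsupp.single 2 1 := by
  intro h
  have := DFunLike.congr_fun h 2
  simp at this

/-- The support of `x₀³ + x₀³x₂`. [folklore] -/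
theorem support_F :
    (X 0 ^ 3 + X 0 ^ 3 * X 2 : MvPolynomial (Fin 4) (ZMod 2)).support =
      {Finsupp.single 0 3, Finsupp.single 0 3 + Finsupp.single 2 1} := by
  rw [F_eq]
  exact support_monomial_add_monomial exponents_ne one_ne_zero one_ne_zero

/-- Every monomial of `x₀³ + x₀³x₂` has `x₀`-exponent `3`. [folklore] -/
theorem apply_zero_of_mem_support {d : Fin 4 →₀ ℕ}
    (hd : d ∈ (X 0 ^ 3 + X 0 ^ 3 * X 2 : MvPolynomial (Fin 4) (ZMod 2)).support) : d 0 = 3 := by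
  rw [support_F, Finset.mem_insert, Finset.mem_singleton] at hd
  rcases hd with rfl | rfl <;> simp

/-- `x₀³ + x₀³x₂` is clean for `q = 2` (every monomial has the odd exponent `3` at `x₀`). [folklore] -/
theorem deletePthPowers_F :
    deletePthPowers 2 (X 0 ^ 3 + X 0 ^ 3 * X 2 : MvPolynomial (Fin 4) (ZMod 2)) =
      X 0 ^ 3 + X 0 ^ 3 * X 2 := by
  ext d
  rw [coeff_deletePthPowers]
  split_ifs with h
  · by_contra hne
    have hd := MvPolynomial.mem_support_iff.mpr (Ne.symm hne)
    have h3 := (isPthPowerExponent_iff 2 d).mp h 0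
    rw [apply_zero_of_mem_support hd] at h3
    omega
  · rfl

/-- `ord₀ (x₀³ + x₀³x₂) = 3`. [folklore] -/
theorem ordZero_F : ordZero (X 0 ^ 3 + X 0 ^ 3 * X 2 : MvPolynomial (Fin 4) (ZMod 2)) = 3 := by
  rw [F_eq, ordZero_add_eq_left_of_lt]
  · rw [ordZero_monomial _ one_ne_zero, Finsupp.degree_single]; rfl
  · rw [ordZero_monomial _ one_ne_zero, ordZero_monomial _ one_ne_zero, Finsupp.degree_single, map_add,
      Finsupp.degree_single, Finsupp.degree_single]
    exact_mod_cast (by norm_num : (3 : ℕ) < 3 + 1)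

/-- `ord_{(x₀)} (x₀³ + x₀³x₂) = 3`. [folklore] -/
theorem ordAlong_F :
    ordAlong ({0} : Finset (Fin 4)) (X 0 ^ 3 + X 0 ^ 3 * X 2 : MvPolynomial (Fin 4) (ZMod 2)) = 3 := by
  refine le_antisymm ?_ (le_ordAlong_of_forall fun d hd => ?_)
  · have hmem : (Finsupp.single 0 3 : Fin 4 →₀ ℕ) ∈
        (X 0 ^ 3 + X 0 ^ 3 * X 2 : MvPolynomial (Fin 4) (ZMod 2)).support := by
      rw [support_F]; exact Finset.mem_insert_self _ _
    refine le_trans (ordAlong_le_of_mem_support hmem) ?_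
    rw [degIn_singleton, Finsupp.single_eq_same]; rfl
  · rw [degIn_singleton, apply_zero_of_mem_support hd]

/-! ## 2. The state, the MODE-1h centre `V(z, x₀)` with `perm2 = 1`, shade `3` -/

/-- `V(z, x₀)` is Hironaka-permissible for `z² + x₀³ + x₀³x₂`. [folklore] -/
theorem isPermissibleCentre :
    IsPermissibleCentre (K := ZMod 2) 2 {0} (X 0 ^ 3 + X 0 ^ 3 * X 2) := by
  refine ⟨Finset.singleton_nonempty 0, ?_⟩
  rw [ordAlong_F]
  exact_mod_cast (by norm_num : (2 : ℕ) ≤ 3)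

/-- `V(z, x₀)` is THE MODE-1h centre (least cardinality among the Hironaka-permissible ones).
[folklore] -/
theorem isMode1hCentre :
    IsMode1hCentre (K := ZMod 2) 2 {0} (X 0 ^ 3 + X 0 ^ 3 * X 2) := by
  refine ⟨isPermissibleCentre, fun S' hS' => ?_⟩
  rw [Finset.card_singleton]
  exact Finset.card_pos.mpr hS'.1

/-- The shade of the state `(x₀³ + x₀³x₂, r = 0, exc = ∅)` is `3`. [folklore] -/
theorem shade_state :
    CState.shade (⟨X 0 ^ 3 + X 0 ^ 3 * X 2, 0, ∅⟩ : State (ZMod 2)) = 3 := by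
  unfold CState.shade
  rw [ordZero_F, map_zero, Nat.cast_zero, tsub_zero]

/-- HP's condition (2) holds for `V(z, x₀)` at the origin (`perm2 = 1`): `0 + 3 ≤ ord_{(x₀)} F = 3`.
[folklore] -/
theorem perm2 : Perm2 (K := ZMod 2) {0} ⟨X 0 ^ 3 + X 0 ^ 3 * X 2, 0, ∅⟩ := by
  unfold Perm2
  rw [shade_state, ordAlong_F, degIn_zero, Nat.cast_zero, zero_add]

/-! ## 3. The special point `c = (0, 0, 1, 0)` of the centre: the moved state is `x₀³x₂`, shade `4` -/

/-- In characteristic `2`: `(x₀³ + x₀³x₂)(x₂ ↦ x₂ + 1) = x₀³x₂`. [folklore] -/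
theorem translate_F :
    PointBlowup.translate (Pi.single 2 1 : Fin 4 → ZMod 2) (X 0 ^ 3 + X 0 ^ 3 * X 2) = X 0 ^ 3 * X 2 := by
  have h2 : (2 : MvPolynomial (Fin 4) (ZMod 2)) = 0 := by
    have := CharP.cast_eq_zero (MvPolynomial (Fin 4) (ZMod 2)) 2
    simpa using this
  unfold PointBlowup.translate
  simp only [map_add, map_mul, map_pow, aeval_X]
  rw [Pi.single_eq_of_ne (show (0 : Fin 4) ≠ 2 by decide), Pi.single_eq_same, C_0, C_1, add_zero]
  have : (X 0 ^ 3 + X 0 ^ 3 * (X 2 + 1) : MvPolynomial (Fin 4) (ZMod 2)) = X 0 ^ 3 * X 2 + 2 * X 0 ^ 3 := by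
    ring
  rw [this, h2, zero_mul, add_zero]

/-- `x₀³x₂` is clean for `q = 2`, so the moved-and-re-cleaned polynomial at `c` is `x₀³x₂`. [folklore] -/
theorem clean_translate_F :
    deletePthPowers 2 (PointBlowup.translate (Pi.single 2 1 : Fin 4 → ZMod 2) (X 0 ^ 3 + X 0 ^ 3 * X 2)) =
      monomial (Finsupp.single 0 3 + Finsupp.single 2 1) 1 := by
  rw [translate_F, X_pow_eq_monomial, X, monomial_mul, one_mul, deletePthPowers_monomial, if_neg]
  intro h
  have h3 := (isPthPowerExponent_iff 2 _).mp h 0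
  simp at h3

/-- **The shade at the special point `c = (0,0,1,0)` of the centre is `4`**, not `3`. [folklore] -/
theorem shade_translate_specialPoint :
    CState.shade (⟨deletePthPowers 2 (PointBlowup.translate (Pi.single 2 1 : Fin 4 → ZMod 2)
        (X 0 ^ 3 + X 0 ^ 3 * X 2)),
      (0 : Fin 4 →₀ ℕ).filter (fun i => (Pi.single 2 1 : Fin 4 → ZMod 2) i = 0),
      (∅ : Finset (Fin 4)).filter (fun i => (Pi.single 2 1 : Fin 4 → ZMod 2) i = 0)⟩ : State (ZMod 2)) = 4 := by
  unfold CState.shade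
  rw [clean_translate_F, ordZero_monomial _ one_ne_zero, Finsupp.filter_zero, map_zero, Nat.cast_zero,
    tsub_zero, map_add, Finsupp.degree_single, Finsupp.degree_single]
  rfl

/-! ## 4. Second witness: a boundary component NOT containing the centre — the jump is GENERIC

`F = x₀²·x₂` with `E = {x₂ = 0}` of multiplicity `1` (`r = (0,0,1,0)`, residual factor `G = x₀²`,
`d = 2`), any field `K` (characteristic `2` is where `q = 2` is the order of `z² + F`; the identities
below are formal). `S = {0}` is the MODE-1h centre and satisfies (2) (`G ∈ (x₀)²`). At EVERY point `c`
of the centre off `E` (`c₂ ≠ 0`) the component is lost, the moved polynomial `x₀²(x₂ + c₂)` re-cleans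
to `x₀²x₂` (the square `c₂x₀²` is deleted), and the shade is `3 = d + 1`: along this centre the shade
is `2` on `E ∩ C_S` and `3` on the dense open `C_S ∖ E`. -/

section Boundary

variable {K : Type} [Field K]

/-- `x₀²x₂` as a monomial. [folklore] -/
theorem FB_eq : (X 0 ^ 2 * X 2 : MvPolynomial (Fin 4) K) =
    monomial (Finsupp.single 0 2 + Finsupp.single 2 1) 1 := by
  rw [X_pow_eq_monomial, X, monomial_mul, one_mul]

omit [Field K] in
/-- The exponent of `x₀²x₂` is not a square exponent (`x₂`-exponent `1`). [folklore] -/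
theorem not_isPthPowerExponent_B :
    ¬ IsPthPowerExponent 2 (Finsupp.single 0 2 + Finsupp.single 2 1 : Fin 4 →₀ ℕ) := by
  intro h
  have h3 := (isPthPowerExponent_iff 2 _).mp h 2
  simp at h3

/-- `x₀²x₂` is clean for `q = 2`. [folklore] -/
theorem deletePthPowers_FB :
    deletePthPowers 2 (X 0 ^ 2 * X 2 : MvPolynomial (Fin 4) K) = X 0 ^ 2 * X 2 := by
  rw [FB_eq, deletePthPowers_monomial, if_neg not_isPthPowerExponent_B]

/-- `ord₀ (x₀²x₂) = 3`. [folklore] -/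
theorem ordZero_FB : ordZero (X 0 ^ 2 * X 2 : MvPolynomial (Fin 4) K) = ((3 : ℕ) : ℕ∞) := by
  rw [FB_eq, ordZero_monomial _ one_ne_zero, map_add, Finsupp.degree_single, Finsupp.degree_single]

/-- `ord_{(x₀)} (x₀²x₂) = 2`. [folklore] -/
theorem ordAlong_FB :
    ordAlong ({0} : Finset (Fin 4)) (X 0 ^ 2 * X 2 : MvPolynomial (Fin 4) K) = ((2 : ℕ) : ℕ∞) := by
  rw [FB_eq, ordAlong_monomial _ _ one_ne_zero, degIn_singleton]
  simp

/-- `V(z, x₀)` is THE MODE-1h centre of `z² + x₀²x₂`. [folklore] -/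
theorem isMode1hCentre_B : IsMode1hCentre (K := K) 2 {0} (X 0 ^ 2 * X 2) := by
  refine ⟨⟨Finset.singleton_nonempty 0, by rw [ordAlong_FB]⟩, fun S' hS' => ?_⟩
  rw [Finset.card_singleton]
  exact Finset.card_pos.mpr hS'.1

/-- The shade of the state `(x₀²x₂, r = (0,0,1,0), exc = {2})` is `2`. [folklore] -/
theorem shade_stateB :
    CState.shade (⟨X 0 ^ 2 * X 2, Finsupp.single 2 1, {2}⟩ : State K) = ((2 : ℕ) : ℕ∞) := by
  unfold CState.shade
  rw [ordZero_FB, Finsupp.degree_single, ← ENat.coe_sub]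

/-- HP's (2) holds for `V(z, x₀)` at the origin: `0 + 2 ≤ ord_{(x₀)} F = 2`. [folklore] -/
theorem perm2_B : Perm2 (K := K) {0} ⟨X 0 ^ 2 * X 2, Finsupp.single 2 1, {2}⟩ := by
  unfold Perm2
  rw [shade_stateB, ordAlong_FB, degIn_singleton, Finsupp.single_apply, if_neg (by decide),
    Nat.cast_zero, zero_add]

/-- At a point `c` of the centre with `c₀ = 0` the moved polynomial is `x₀²x₂ + c₂x₀²` and re-cleans
to `x₀²x₂` (the square `c₂x₀²` is deleted). [folklore] -/
theorem clean_translate_FB (c : Fin 4 → K) (hc0 : c 0 = 0) :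
    deletePthPowers 2 (PointBlowup.translate c (X 0 ^ 2 * X 2 : MvPolynomial (Fin 4) K)) =
      monomial (Finsupp.single 0 2 + Finsupp.single 2 1) 1 := by
  have ht : PointBlowup.translate c (X 0 ^ 2 * X 2 : MvPolynomial (Fin 4) K) =
      monomial (Finsupp.single 0 2 + Finsupp.single 2 1) 1 + monomial (Finsupp.single 0 2) (c 2) := by
    unfold PointBlowup.translate
    simp only [map_mul, map_pow, aeval_X]
    rw [hc0, C_0, add_zero, mul_add, X_pow_eq_monomial, X, monomial_mul, one_mul, mul_comm,
      C_mul_monomial, mul_one]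
  have hsq : IsPthPowerExponent 2 (Finsupp.single 0 2 : Fin 4 →₀ ℕ) :=
    (isPthPowerExponent_iff 2 _).mpr fun i => by
      rw [Finsupp.single_apply]
      split_ifs
      · exact dvd_refl 2
      · exact dvd_zero 2
  rw [ht, deletePthPowers_add, deletePthPowers_monomial, if_neg not_isPthPowerExponent_B,
    deletePthPowers_monomial, if_pos hsq, add_zero]

/-- **Off the boundary component the shade along the centre is `3 = d + 1`** (every `c` with
`c₀ = 0`, `c₂ ≠ 0`; the component `{x₂ = 0}` is lost at `c`). [folklore] -/
theorem shade_translate_offBoundary [DecidableEq K] (c : Fin 4 → K) (hc0 : c 0 = 0) (hc2 : c 2 ≠ 0) :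
    CState.shade (⟨deletePthPowers 2 (PointBlowup.translate c (X 0 ^ 2 * X 2)),
      (Finsupp.single 2 1 : Fin 4 →₀ ℕ).filter (fun i => c i = 0),
      ({2} : Finset (Fin 4)).filter (fun i => c i = 0)⟩ : State K) = ((3 : ℕ) : ℕ∞) := by
  have hr : (Finsupp.single 2 1 : Fin 4 →₀ ℕ).filter (fun i => c i = 0) = 0 := by
    ext i
    rw [Finsupp.filter_apply, Finsupp.coe_zero, Pi.zero_apply, Finsupp.single_apply]
    by_cases hi : (2 : Fin 4) = i
    · subst hi; rw [if_neg hc2]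
    · rw [if_neg hi, ite_self]
  unfold CState.shade
  rw [clean_translate_FB c hc0, ordZero_monomial _ one_ne_zero, hr, map_zero, Nat.cast_zero, tsub_zero,
    map_add, Finsupp.degree_single, Finsupp.degree_single]

/-- **Second witness, every field**: for the clean state `(x₀²x₂, r = (0,0,1,0), exc = {2})` the
MODE-1h centre `S = {0}` satisfies (2), the shade at the origin is `2`, and at EVERY point of the
centre off `E = {x₂ = 0}` it is `3`. [folklore] -/
theorem shade_jumps_offBoundary [DecidableEq K] :
    IsMode1hCentre (K := K) 2 {0} (X 0 ^ 2 * X 2) ∧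
      Perm2 (K := K) {0} ⟨X 0 ^ 2 * X 2, Finsupp.single 2 1, {2}⟩ ∧
      deletePthPowers 2 (X 0 ^ 2 * X 2 : MvPolynomial (Fin 4) K) = X 0 ^ 2 * X 2 ∧
      (∀ d ∈ (X 0 ^ 2 * X 2 : MvPolynomial (Fin 4) K).support, Finsupp.single 2 1 ≤ d) ∧
      CState.shade (⟨X 0 ^ 2 * X 2, Finsupp.single 2 1, {2}⟩ : State K) = ((2 : ℕ) : ℕ∞) ∧
      ∀ c : Fin 4 → K, c 0 = 0 → c 2 ≠ 0 →
        CState.shade (⟨deletePthPowers 2 (PointBlowup.translate c (X 0 ^ 2 * X 2)),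
          (Finsupp.single 2 1 : Fin 4 →₀ ℕ).filter (fun i => c i = 0),
          ({2} : Finset (Fin 4)).filter (fun i => c i = 0)⟩ : State K) = ((3 : ℕ) : ℕ∞) := by
  refine ⟨isMode1hCentre_B, perm2_B, deletePthPowers_FB, fun d hd => ?_, shade_stateB,
    fun c hc0 hc2 => shade_translate_offBoundary c hc0 hc2⟩
  rw [FB_eq, support_monomial, if_neg one_ne_zero, Finset.mem_singleton] at hd
  rw [hd]
  exact le_add_self

end Boundary

/-! ## 5. (iii) as worded is false -/


/-- **«The shade is constant along a MODE-1h centre with perm2 = 1» is FALSE (class `(4,1)`,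
`p = 2`).** There is a clean presented state `s` (no exceptional divisor), a MODE-1h centre `S` for it
satisfying HP's (2), and a point `c` of the centre at which the moved-and-re-cleaned state has a
LARGER shade (`3 < 4`). Negative census fact about OUR frame; the true statement is the inequality
`shade(s) ≤ shade(s@c)` of `MohAlong.shade_le_shade_translate`. [folklore] -/
theorem not_shadeConstantAlongMode1hCentre :
    ∃ (s : State (ZMod 2)) (S : Finset (Fin 4)) (c : Fin 4 → ZMod 2),
      deletePthPowers 2 s.F = s.F ∧ s.F ≠ 0 ∧ (∀ d ∈ s.F.support, s.r ≤ d) ∧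
      IsMode1hCentre 2 S s.F ∧ Perm2 S s ∧ (∀ i ∈ S, c i = 0) ∧
      s.shade < CState.shade ⟨deletePthPowers 2 (PointBlowup.translate c s.F),
        s.r.filter (fun i => c i = 0), s.exc.filter (fun i => c i = 0)⟩ := by
  refine ⟨⟨X 0 ^ 3 + X 0 ^ 3 * X 2, 0, ∅⟩, {0}, Pi.single 2 1, deletePthPowers_F, ?_, fun d _ => bot_le,
    isMode1hCentre, perm2, fun i hi => ?_, ?_⟩
  · intro h
    have := congrArg ordZero h
    rw [ordZero_F, ordZero_zero] at this
    exact ENat.coe_ne_top 3 this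
  · rw [Finset.mem_singleton] at hi
    subst hi
    exact Pi.single_eq_of_ne (show (0 : Fin 4) ≠ 2 by decide) _
  · rw [shade_state, shade_translate_specialPoint]
    exact_mod_cast (by norm_num : (3 : ℕ) < 4)

end SpecialPoint

end MohAlong

end Summit.ResolutionOfSingularities.ResolutionOfSingularities.Theorems.PIDim4

end
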